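import Summits.HodgeConjecture.HodgeConjecture.Theses.EisensteinMiddleThird
import Literature.AlgebraicGeometry.HodgeTheory.DivisorInduction
import Literature.AlgebraicGeometry.HodgeTheory.LefschetzOneOneHolds
import HarnessLib

/-!
# Birth skeleton — piece X₁ `ConiveauOneMiddleFourfold` of the split of `EisensteinTowerHodge`
# (stmt-HodgeConjecture-18997; route EisensteinMiddleThird, crux-strategist 2026-08-17)

KNOWN-GRADE piece: on a smooth projective complex fourfold every rational `(2,2)`-class of coniveau
`≥ 1` is algebraic. Two registered stubs = the two catalogued, undischarged named facts of the tree
that carry Deligne's printed proof, and the kernel-checked composition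
`coniveauOneMiddleFourfold_of` = `divisorInduction_of_deligne_of_hodgeClassLift` at `(n, p) = (3, 2)`
with the tree's PROVED Lefschetz `(1,1)` (`lefschetzOneOne_rational_holds`) as the codimension-one
input on threefolds. The conclusion is the route decl `EisensteinMiddleThird.ConiveauOneMiddleFourfold` BY NAME (route file rev ≥ 10).
-/

noncomputable section

set_option linter.dupNamespace false

namespace Summit.HodgeConjecture.HodgeConjecture.Cruxes.EisensteinTowerHodge.SplitConiveauOne

open CategoryTheory
open Literature.AlgebraicGeometry Literature.AlgebraicGeometry.Motives
  Literature.AlgebraicGeometry.HodgeTheory Literature.AlgebraicTopology.SingularHomology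

/-- stub 1 — Deligne, Hodge III Cor. 8.2.8 (support form): the classes dying off `⋃ⱼ gⱼ(Yⱼ)` are the
sum of the Gysin images (tree fact `Deligne1974_ker_restrictCompl_eq_iSup_range_complexGysin`, XL,
open; its discharge is the hodge family's shared debt `GysinKernelSplit`). -/
theorem stub_deligneGysinKernel : Deligne1974_ker_restrictCompl_eq_iSup_range_complexGysin := by
  sorry

/-- stub 2 — Voisin 2025 Cor. 2.12 / Jannsen Thm. 7.9: a rational `(q,q)`-class in a sum of Gysin
images is a combination of Gysin images of rational `(d,d)`-classes (semisimplicity of polarisable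
Hodge structures; tree fact `Voisin2025_hodgeClass_lift_complexGysin`, XL, open). -/
theorem stub_hodgeClassLift : Voisin2025_hodgeClass_lift_complexGysin := by
  sorry

/-- **Composition** (no sorry): the two stubs give the piece — divisor induction at `(n,p) = (3,2)`
fed with the PROVED Lefschetz `(1,1)` on threefolds. -/
theorem coniveauOneMiddleFourfold_of :
    Deligne1974_ker_restrictCompl_eq_iSup_range_complexGysin →
      Voisin2025_hodgeClass_lift_complexGysin → Summit.HodgeConjecture.HodgeConjecture.Theses.EisensteinMiddleThird.ConiveauOneMiddleFourfold := by
  intro hA hB X hX c hc hpp hs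
  exact divisorInduction_of_deligne_of_hodgeClassLift hA hB 3 2 (by norm_num)
    (fun Y hY c' hc' hpp' ↦ lefschetzOneOne_rational_holds hY c' hc' hpp') hX c hc hpp hs

/-- The piece from the registered stubs (sorries only inside `stub_*`). -/
theorem coniveauOneMiddleFourfold_holds_of_stubs : Summit.HodgeConjecture.HodgeConjecture.Theses.EisensteinMiddleThird.ConiveauOneMiddleFourfold :=
  coniveauOneMiddleFourfold_of stub_deligneGysinKernel stub_hodgeClassLift

end Summit.HodgeConjecture.HodgeConjecture.Cruxes.EisensteinTowerHodge.SplitConiveauOne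

end
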